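import Summits.ABC.IUTFork.Repair.RH2SigmaHullExponent
import HarnessLib

/-!
# R-H ROUND 2, Q2 hull-reach family × EXP F5 — the PER-ROW σ-instances with the licence binder DISCHARGED:
# row 18 `σ := Σ₁₈(T)` (level window, dictionary-free) and row 15 `σ := Σ₁₅(T; n₀, λ, m_q)` (slot-reach window of a certified dictionary)

PROOF-ONLY file (D-0012: 0 definitions, 0 `Prop` facts, no instance, no notation; abc-iut cell, rung LADDER-ABC:A2.RESCUE.H; seat abc-iut-rh2-q2-hull gen 5;
companion of `Repair/RH2SigmaHullExponent.lean`). TAKES NO SIDE on [IUTchIII] Cor. 3.12 or on any author; nothing asserts abc proved or refuted; typed ≠ proved.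

For the hull rows whose stratum is a set of CELLS read off the datum, the (xi-f) licence ON the stratum is a theorem at the genuine bed with the chosen
realising ideles (`licenceOn_sigmaLevelWindow_chosen`, `licenceOn_sigmaSlotReach_chosen`), so abc-iut-rh2-T-1's F5 (a) endpoint p485274 holds there with
[LIC] DISCHARGED and the stratum's MASS the only Σ-hypothesis — and that mass is COMPUTABLE from the datum (rh-lead MIN-SLICE §(v): per bad place the licensed
labels are an initial segment `j ≤ j₀(v)`, `μ(T) = Σ_v S(j₀(v))·h_v / (S(l⋆)·Σ_v h_v)`, `S(n) = n(n−1)(2n+5)/6`):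

* `abcExpOn_farFromCusps_of_mu_sigma18_content_hregC` / `…_szpiroBad_degOne` — ROW 18 (abc-iut-rh2-xi-2's `RH.InSigmaDatum.sigmaLevelWindow` at the chosen
  ideles; NO dictionary): explicit 2 = [MU-C at Σ₁₈]·[CONE-C], resp. CONE-FREE explicit 1 = [MU₁-bad at Σ₁₈] at the Szpiro-bad admissible RATIONAL data —
  «if the exact-level cells of every such datum retain `≥ μ₀·gap − Tol` of the `(j²−1)`-mass, then abc with exponent `1/μ₀` on every far-from-cusps family».
* `abcExpOn_farFromCusps_of_mu_sigma15_content_hregC` / `…_szpiroBad_degOne` — ROW 15 (abc-iut-rh-typ-12's `RHSlotReach.sigmaSlotReach`, `e = ramIdx`,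
  `m_Θ = j²·m_q`): the Σ-hypothesis is «SOME certified dictionary `(n₀, λ, m_q)` of the datum (inner non-log-unit / outer log-unit / integer Kummer-order
  certificates — inhabited side conditions, cf. p470562 `exists_intKummerOrders`) has a slot-reach window retaining `≥ μ₀·gap − Tol`»; routed through the
  hypothesis-minimal `Σ_lic` endpoint (`Σ₁₅ ⊆ Σ_lic`, `offTrivialMass_licenceCells_le_of_licenceOn_chosen`), which absorbs the existential.
Rows 8 ⊆ 15 (p470562 `exists_certifiedWindow_of_hBand`: an `HBand` datum has a certified dictionary with the window on ALL cells, `B_triv = 0`) and 20′ ⊇ 15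
(abc-iut-rh-typ-7 `RHLinearReachLawMixedVsSlotReach`) need no separate instance. BINDER STATUS as in the companion: content-cut forms engage no tabulated datum
(B23); the cone-free Szpiro-bad forms ARE engaged at the tier-1 Frey–Legendre data (p480214), where the slice fractions of record are numerics, not theorems
(FREY-133 median `μ ≈ 0.52`, exact envelope `0.84`) — undecided as typed; «follows AS TYPED», nothing more; instantiated ≠ endorsed.
[claim: Mochizuki2012, status: disputed] [cite: Mochizuki2012, IUTchIII Cor. 3.12 p. 173–174, Step (xi-f) p. 184; IUTchIV Thm. 1.10 pp. 22–31, Cor. 2.2 (ii)–(iii)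
pp. 41–48] [cite: MochizukiGenEll2010, Thm 2.1 p.11–12] [cite: DupuyHilado2025, §3.3, §3.4, §3.9, §4.9]
-/

noncomputable section

open Set Function
namespace Summit.ABC.IUTFork.Repair.RH2SigmaHull

open Thm311 Thm311.Real Cor312 Cor312.Setting Cor312Vol Cor312Prov Literature.IUT.LogThetaLattice Literature.IUT.LogVolume
  Literature.IUT.HodgeTheaters Literature.IUT.LogVolume.ThetaData
open Literature.NumberTheory.NumberFields NumberField IsDedekindDomain Metric RHSlotReach RH RH.InSigmaDatum RH.SigmaLicence RH.SigmaMass RH.OffSigma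
open Literature.NumberTheory.DiophantineGeometry Literature.NumberTheory.DiophantineGeometry.GenEll Summit.ABC.ABC.Theorems Conditional Conditional.SigmaMass

section Rows

/-! The certificates' column data (the binders `M … qData` of the F5 endpoint, VERBATIM), once for the whole section. -/
variable (M : ∀ (P : NFPoint) (l : ℕ) (T : Cor22.ThetaVolumeDatumAt P l), Type) [∀ P l T, Field (M P l T)] [∀ P l T, NumberField (M P l T)]
    (archPk : ∀ (P : NFPoint) (l : ℕ) (T : Cor22.ThetaVolumeDatumAt P l), letI := T.instFieldF; letI := T.instNumberFieldF; letI := T.instAlgebraF; letI := T.instFieldK;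
        letI := T.instNumberFieldK; letI := T.instAlgebraK; letI := T.instFieldFbar; letI := T.instAlgebraFbar;
        letI := T.instAlgebraKFbar; letI := T.instIsElliptic;
      ∀ (j : (thetaIndex (pilotDataOfK T.D T.K)).Label) (vQ : (thetaIndex (pilotDataOfK T.D T.K)).VQ), Set ((logShellsDH (pilotDataOfK T.D T.K) (analyticLogv T.K)).Packet j vQ))
    (archSub : ∀ (P : NFPoint) (l : ℕ) (T : Cor22.ThetaVolumeDatumAt P l), letI := T.instFieldF; letI := T.instNumberFieldF; letI := T.instAlgebraF; letI := T.instFieldK;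
        letI := T.instNumberFieldK; letI := T.instAlgebraK; letI := T.instFieldFbar; letI := T.instAlgebraFbar;
        letI := T.instAlgebraKFbar; letI := T.instIsElliptic;
      ∀ (j : (thetaIndex (pilotDataOfK T.D T.K)).Label) (v : (thetaIndex (pilotDataOfK T.D T.K)).V), Set ((logShellsDH (pilotDataOfK T.D T.K) (analyticLogv T.K)).Packet j ((thetaIndex (pilotDataOfK T.D T.K)).over v)))
    (Ψ : ∀ (P : NFPoint) (l : ℕ) (T : Cor22.ThetaVolumeDatumAt P l), letI := T.instFieldF; letI := T.instNumberFieldF; letI := T.instAlgebraF; letI := T.instFieldK;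
        letI := T.instNumberFieldK; letI := T.instAlgebraK; letI := T.instFieldFbar; letI := T.instAlgebraFbar;
        letI := T.instAlgebraKFbar; letI := T.instIsElliptic;
      ℤ → ∀ v : (thetaIndex (pilotDataOfK T.D T.K)).V, v ∈ (thetaIndex (pilotDataOfK T.D T.K)).Vbad → Set ((logShellsDH (pilotDataOfK T.D T.K) (analyticLogv T.K)).StarPacket v))
    (act : ∀ (P : NFPoint) (l : ℕ) (T : Cor22.ThetaVolumeDatumAt P l), letI := T.instFieldF; letI := T.instNumberFieldF; letI := T.instAlgebraF; letI := T.instFieldK;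
        letI := T.instNumberFieldK; letI := T.instAlgebraK; letI := T.instFieldFbar; letI := T.instAlgebraFbar;
        letI := T.instAlgebraKFbar; letI := T.instIsElliptic;
      ℤ → ∀ v : (thetaIndex (pilotDataOfK T.D T.K)).V, v ∈ (thetaIndex (pilotDataOfK T.D T.K)).Vbad → (logShellsDH (pilotDataOfK T.D T.K) (analyticLogv T.K)).StarPacket v → Module.End ℚ ((logShellsDH (pilotDataOfK T.D T.K) (analyticLogv T.K)).StarPacket v))
    (Mmod : ∀ (P : NFPoint) (l : ℕ) (T : Cor22.ThetaVolumeDatumAt P l), letI := T.instFieldF; letI := T.instNumberFieldF; letI := T.instAlgebraF; letI := T.instFieldK;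
        letI := T.instNumberFieldK; letI := T.instAlgebraK; letI := T.instFieldFbar; letI := T.instAlgebraFbar;
        letI := T.instAlgebraKFbar; letI := T.instIsElliptic;
      ℤ → ∀ j : (thetaIndex (pilotDataOfK T.D T.K)).LabelStar, Set ((logShellsDH (pilotDataOfK T.D T.K) (analyticLogv T.K)).GlobalPacket j.1))
    (region : ∀ (P : NFPoint) (l : ℕ) (T : Cor22.ThetaVolumeDatumAt P l), letI := T.instFieldF; letI := T.instNumberFieldF; letI := T.instAlgebraF; letI := T.instFieldK;
        letI := T.instNumberFieldK; letI := T.instAlgebraK; letI := T.instFieldFbar; letI := T.instAlgebraFbar;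
        letI := T.instAlgebraKFbar; letI := T.instIsElliptic;
      ℤ → ∀ j : (thetaIndex (pilotDataOfK T.D T.K)).LabelStar, FinDivisor (M P l T) → ∀ vQ : (thetaIndex (pilotDataOfK T.D T.K)).VQ, Set ((logShellsDH (pilotDataOfK T.D T.K) (analyticLogv T.K)).Packet j.1 vQ))
    (n : ∀ (P : NFPoint) (l : ℕ) (T : Cor22.ThetaVolumeDatumAt P l), ℤ)
    {HT : ∀ (P : NFPoint) (l : ℕ) (T : Cor22.ThetaVolumeDatumAt P l), Type} {LogLink : ∀ (P : NFPoint) (l : ℕ) (T : Cor22.ThetaVolumeDatumAt P l), HT P l T → HT P l T → Type}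
    {IsFull : ∀ (P : NFPoint) (l : ℕ) (T : Cor22.ThetaVolumeDatumAt P l), ∀ {s t : HT P l T}, LogLink P l T s t → Prop}
    (lat : ∀ (P : NFPoint) (l : ℕ) (T : Cor22.ThetaVolumeDatumAt P l), LGPGaussianLogThetaLattice (LogLink P l T) (IsFull P l T))
    {Frd : ∀ (P : NFPoint) (l : ℕ) (T : Cor22.ThetaVolumeDatumAt P l), Type} {IsoF : ∀ (P : NFPoint) (l : ℕ) (T : Cor22.ThetaVolumeDatumAt P l), Frd P l T → Frd P l T → Type} {Ob : ∀ (P : NFPoint) (l : ℕ) (T : Cor22.ThetaVolumeDatumAt P l), Frd P l T → Type}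
    {realify : ∀ (P : NFPoint) (l : ℕ) (T : Cor22.ThetaVolumeDatumAt P l), Frd P l T → Frd P l T} {Strip : ∀ (P : NFPoint) (l : ℕ) (T : Cor22.ThetaVolumeDatumAt P l), Type} {IsoS : ∀ (P : NFPoint) (l : ℕ) (T : Cor22.ThetaVolumeDatumAt P l), Strip P l T → Strip P l T → Type}
    {Mv : ∀ (P : NFPoint) (l : ℕ) (T : Cor22.ThetaVolumeDatumAt P l), letI := T.instFieldF; letI := T.instNumberFieldF; letI := T.instAlgebraF; letI := T.instFieldK;
        letI := T.instNumberFieldK; letI := T.instAlgebraK; letI := T.instFieldFbar; letI := T.instAlgebraFbar;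
        letI := T.instAlgebraKFbar; letI := T.instIsElliptic;
      ∀ v : (thetaIndex (pilotDataOfK T.D T.K)).V, v ∈ (thetaIndex (pilotDataOfK T.D T.K)).Vbad → Type}
    [∀ P l T v h, Monoid (Mv P l T v h)]
    (sig : ∀ (P : NFPoint) (l : ℕ) (T : Cor22.ThetaVolumeDatumAt P l), letI := T.instFieldF; letI := T.instNumberFieldF; letI := T.instAlgebraF; letI := T.instFieldK;
        letI := T.instNumberFieldK; letI := T.instAlgebraK; letI := T.instFieldFbar; letI := T.instAlgebraFbar;
        letI := T.instAlgebraKFbar; letI := T.instIsElliptic;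
      GlobalLGPFrobenioidSignature (thetaIndex (pilotDataOfK T.D T.K)).lstar (thetaIndex (pilotDataOfK T.D T.K)).V (· ∈ (thetaIndex (pilotDataOfK T.D T.K)).Vbad) (Frd P l T) (IsoF P l T) (Ob P l T) (realify P l T)
        (Strip P l T) (IsoS P l T) (Mv P l T))
    (split : ∀ (P : NFPoint) (l : ℕ) (T : Cor22.ThetaVolumeDatumAt P l), SplittingMonoids (Mv P l T))
    {ObΔ : ∀ (P : NFPoint) (l : ℕ) (T : Cor22.ThetaVolumeDatumAt P l), Type} {N : ∀ (P : NFPoint) (l : ℕ) (T : Cor22.ThetaVolumeDatumAt P l), letI := T.instFieldF; letI := T.instNumberFieldF; letI := T.instAlgebraF; letI := T.instFieldK;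
        letI := T.instNumberFieldK; letI := T.instAlgebraK; letI := T.instFieldFbar; letI := T.instAlgebraFbar;
        letI := T.instAlgebraKFbar; letI := T.instIsElliptic;
      ∀ v : (thetaIndex (pilotDataOfK T.D T.K)).V, v ∈ (thetaIndex (pilotDataOfK T.D T.K)).Vbad → Type}
    [∀ P l T v h, Monoid (N P l T v h)] (qData : ∀ (P : NFPoint) (l : ℕ) (T : Cor22.ThetaVolumeDatumAt P l), QPilotData (ObΔ P l T) (N P l T))

/-! ## §1. ROW 18: `σ := Σ₁₈(T)` — the level window at the chosen realising ideles (dictionary-free; licence on it a theorem) -/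

/-- **`abcExpOn_farFromCusps_of_mu_sigma18_content_hregC` — F5 (a) AT ROW 18's Σ₁₈, LICENCE DISCHARGED.** Explicit 2 = [MU-C at Σ₁₈] 1 · [CONE-C] 1: for
`μ₀ ∈ (0, 1]`, IF at every admissible `(P, l)` on the content locus and every genuine Θ-volume datum `T` the exact-level cells
`Σ₁₈(T) := sigmaLevelWindow (pilotDataOfK T.D T.K) t_q t_Θ` (abc-iut-rh2-xi-2; chosen realising ideles) retain the mass, `B_triv(Σ₁₈(T)ᶜ) ≤ (1−μ₀)·T.gap + Tol(P,l)`
(abc-iut-rh2-xi-1's `OffSigmaTolerance` VERBATIM), and [CONE-C] `hregC` (abc-iut-C-cert-1's binder VERBATIM), THEN for every `ρ ∈ (0, 1/2]`: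
**`ABCWithExponentOn {λ | λ ρ-far from the cusps at ∞ and 2} (1/μ₀)`**. PROOF = abc-iut-rh2-T-1's p485274 at `σ := Σ₁₈` with [LIC-C] := the companion's
`licenceOn_sigmaLevelWindow_chosen` (abc-iut-rh2-xi-2 `licenceAt_of_mem_sigmaLevelWindow`). CONDITIONAL; the mass binder engages no tabulated datum (content locus);
«follows AS TYPED», nothing more; no side taken on [IUTchIII] Cor. 3.12 or on any author. [cite: Mochizuki2012, IUTchIV Thm. 1.10 pp. 22–31; Cor. 2.2 (ii)–(iii)
pp. 41–48] [cite: MochizukiGenEll2010, Thm 2.1 p.11–12] [cite: DupuyHilado2025, §3.9, §4.9] [claim: Mochizuki2012, status: disputed] -/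
theorem abcExpOn_farFromCusps_of_mu_sigma18_content_hregC {μ₀ : ℝ} (hμ₀ : 0 < μ₀) (hμ₁ : μ₀ ≤ 1)
    -- [MU-C at Σ₁₈] the level-window cells retain `≥ μ₀·T.gap − Tol(P,l)` of the mass at every content-locus datum
    (hMu18 : ∀ P : NFPoint, P ∈ UP → ∀ l : ℕ, l.Prime → 5 ≤ l →
      Cor22.AdmitsCore P → Cor22.CondP2 P l → Cor22.CondP5 P l → Cor22.CondP6 P l →
      6 * ((1 + 20 * (Cor22.dmod P : ℝ) / l) * (P.logDiff + Cor22.logCondAvoid P {2, l}))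
          + 120 * (2 ^ 12 * 3 ^ 3 * 5 * (Cor22.dmod P : ℝ) * l) < Cor22.logQAvoid P {2, l} →
      ∀ T : Cor22.ThetaVolumeDatumAt P l, letI := T.instFieldF; letI := T.instNumberFieldF; letI := T.instAlgebraF; letI := T.instFieldK;
        letI := T.instNumberFieldK; letI := T.instAlgebraK; letI := T.instFieldFbar; letI := T.instAlgebraFbar;
        letI := T.instAlgebraKFbar; letI := T.instIsElliptic;
      OffSigmaTolerance (1 - μ₀) (tol P l) T
        (offTrivialMass
          (settingPrVolSharp (pilotDataOfK T.D T.K) (logvAnalytic_analyticLogv (F := T.K)) (M P l T) (archPk P l T) (archSub P l T) (Ψ P l T)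
          (act P l T) (Mmod P l T) (region P l T) (n P l T) (lat P l T) (sig P l T) (split P l T) (qData P l T)
          (exists_realising_qIdeles_pilotDataOfK T.D).choose
          (exists_realising_thetaIdeles_pilotDataOfK T.D).choose
          (exists_realising_qIdeles_pilotDataOfK T.D).choose_spec.1
          (exists_realising_qIdeles_pilotDataOfK T.D).choose_spec.2.1)
          (sigmaLevelWindow (pilotDataOfK T.D T.K) (exists_realising_qIdeles_pilotDataOfK T.D).choose
            (exists_realising_thetaIdeles_pilotDataOfK T.D).choose)))
    -- [CONE-C] abc-iut-C-cert-1's `hregC` VERBATIM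
    (hregC : ∀ P : NFPoint, P ∈ UP → ∀ l : ℕ, l.Prime → 5 ≤ l →
      Cor22.AdmitsCore P → Cor22.CondP2 P l → Cor22.CondP5 P l → Cor22.CondP6 P l →
      6 * ((1 + 20 * (Cor22.dmod P : ℝ) / l) * (P.logDiff + Cor22.logCondAvoid P {2, l}))
          + 120 * (2 ^ 12 * 3 ^ 3 * 5 * (Cor22.dmod P : ℝ) * l) < Cor22.logQAvoid P {2, l} →
      ∀ T : Cor22.ThetaVolumeDatumAt P l,
        (letI := T.instFieldF; letI := T.instNumberFieldF; letI := T.instAlgebraF; letI := T.instFieldK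
         letI := T.instNumberFieldK; letI := T.instAlgebraK; letI := T.instFieldFbar; letI := T.instAlgebraFbar
         letI := T.instAlgebraKFbar; letI := T.instIsElliptic
         ¬ (∀ p ∈ T.I.supportPrimes, ∀ v w : placesOver (fieldOfModuli T.E) p,
            (Summit.ABC.IUTFork.DHData.ofInput T.I).logQloc p v = (Summit.ABC.IUTFork.DHData.ofInput T.I).logQloc p w)) →
        T.HullEstimateOf
          (((l : ℝ) + 1) / 4 *
            ((1 + 12 * (Cor22.dmod P : ℝ) / l) * (P.logDiff + Cor22.logCondAvoid P {2, l})
              + 2 * Real.log l + 52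
              + 20 / 3 * Real.log (((2 ^ 12 * 3 ^ 3 * 5 * Cor22.dmod P : ℕ) : ℝ) * (l : ℝ))
                * (Nat.primeCounting (2 ^ 12 * 3 ^ 3 * 5 * Cor22.dmod P * l) : ℝ))))
    {ρ : ℝ} (h0 : 0 < ρ) (h2 : ρ ≤ 1 / 2) :
    ABCWithExponentOn {P : NFPoint | P.FarFromCusps ({2} : Finset ℕ) ρ} (1 / μ₀) :=
  abcExpOn_farFromCusps_of_licenceOn_mu_content_hregC hμ₀ hμ₁ M archPk archSub Ψ act Mmod region n lat sig split qData
    (fun P l T => letI := T.instFieldF; letI := T.instNumberFieldF; letI := T.instAlgebraF; letI := T.instFieldK;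
        letI := T.instNumberFieldK; letI := T.instAlgebraK; letI := T.instFieldFbar; letI := T.instAlgebraFbar;
        letI := T.instAlgebraKFbar; letI := T.instIsElliptic;
      sigmaLevelWindow (pilotDataOfK T.D T.K) (exists_realising_qIdeles_pilotDataOfK T.D).choose
        (exists_realising_thetaIdeles_pilotDataOfK T.D).choose)
    (fun P _ l _ _ _ _ _ _ _ T => by
      letI := T.instFieldF; letI := T.instNumberFieldF; letI := T.instAlgebraF; letI := T.instFieldK
      letI := T.instNumberFieldK; letI := T.instAlgebraK; letI := T.instFieldFbar; letI := T.instAlgebraFbar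
      letI := T.instAlgebraKFbar; letI := T.instIsElliptic
      exact licenceOn_sigmaLevelWindow_chosen T.D (M P l T) (archPk P l T) (archSub P l T) (Ψ P l T) (act P l T) (Mmod P l T) (region P l T)
        (n P l T) (lat P l T) (sig P l T) (split P l T) (qData P l T))
    hMu18 hregC h0 h2

/-- **`abcExpOn_farFromCusps_of_mu_sigma18_szpiroBad_degOne` — F5 (a) CONE-FREE AT ROW 18's Σ₁₈: ONE HYPOTHESIS.** Explicit 1 = [MU₁-bad at Σ₁₈]: for
`μ₀ ∈ (0, 1]`, IF at every SZPIRO-BAD admissible RATIONAL `(P, l)` (guard of `Cor22.forall_cor312Of_of_szpiroBad` VERBATIM) and every genuine Θ-volume datum `T`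
the exact-level cells `Σ₁₈(T)` retain `≥ μ₀·T.gap − Tol(P,l)` of the `(j²−1)`-mass, THEN for every `ρ ∈ (0, 1/2]`:
**`ABCWithExponentOn {λ ρ-far from the cusps at ∞, 2} (1/μ₀)`** — «S|Σ₁₈ ⟹ abc with exponent `1/μ₀`» with S|Σ₁₈ a THEOREM (p485274 §2 at `σ := Σ₁₈`,
[LIC₁-bad] := `licenceOn_sigmaLevelWindow_chosen`). HONEST STATUS: engaged at the tier-1 Frey–Legendre data (p480214), undecided as typed there; at each datum the
binder holds at the datum's own level-window mass fraction for free (abc-iut-rh2-w-1 `offSigmaTolerance_offTrivialMass_massFrac_chosen`). CONDITIONAL; no side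
taken on [IUTchIII] Cor. 3.12 or on any author. [cite: Mochizuki2012, IUTchIV Cor. 2.2 (ii)–(iii) pp. 41–48] [cite: DupuyHilado2025, §3.9, §4.9]
[claim: Mochizuki2012, status: disputed] -/
theorem abcExpOn_farFromCusps_of_mu_sigma18_szpiroBad_degOne {μ₀ : ℝ} (hμ₀ : 0 < μ₀) (hμ₁ : μ₀ ≤ 1)
    -- [MU₁-bad at Σ₁₈] the level-window cells retain `≥ μ₀·T.gap − Tol(P,l)` of the mass at every Szpiro-bad admissible RATIONAL datum
    (hMu18₁ : ∀ P : NFPoint, P ∈ UP → P.degree ≤ 1 → ∀ l : ℕ, l.Prime → 5 ≤ l →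
      Cor22.AdmitsCore P → Cor22.CondP2 P l → Cor22.CondP5 P l → Cor22.CondP6 P l →
      (((l : ℝ) + 5) / 4 < (Cor22.dmod P : ℝ) ∨
        6 * l * (((l : ℝ) + 5) - 4 * Cor22.dmod P) / (((l : ℝ) + 4) * ((l : ℝ) - 3))
            * (P.logDiff + (1 - 1 / (l : ℝ)) * Cor22.logCondAvoid P {2, l})
          + 6 * l * ((l : ℝ) + 5) / (((l : ℝ) + 4) * ((l : ℝ) - 3)) * Real.log Real.pi < Cor22.logQAvoid P {2, l}) →
      ∀ T : Cor22.ThetaVolumeDatumAt P l, letI := T.instFieldF; letI := T.instNumberFieldF; letI := T.instAlgebraF; letI := T.instFieldK;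
        letI := T.instNumberFieldK; letI := T.instAlgebraK; letI := T.instFieldFbar; letI := T.instAlgebraFbar;
        letI := T.instAlgebraKFbar; letI := T.instIsElliptic;
      OffSigmaTolerance (1 - μ₀) (tol P l) T
        (offTrivialMass
          (settingPrVolSharp (pilotDataOfK T.D T.K) (logvAnalytic_analyticLogv (F := T.K)) (M P l T) (archPk P l T) (archSub P l T) (Ψ P l T)
          (act P l T) (Mmod P l T) (region P l T) (n P l T) (lat P l T) (sig P l T) (split P l T) (qData P l T)
          (exists_realising_qIdeles_pilotDataOfK T.D).choose
          (exists_realising_thetaIdeles_pilotDataOfK T.D).choose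
          (exists_realising_qIdeles_pilotDataOfK T.D).choose_spec.1
          (exists_realising_qIdeles_pilotDataOfK T.D).choose_spec.2.1)
          (sigmaLevelWindow (pilotDataOfK T.D T.K) (exists_realising_qIdeles_pilotDataOfK T.D).choose
            (exists_realising_thetaIdeles_pilotDataOfK T.D).choose)))
    {ρ : ℝ} (h0 : 0 < ρ) (h2 : ρ ≤ 1 / 2) :
    ABCWithExponentOn {P : NFPoint | P.FarFromCusps ({2} : Finset ℕ) ρ} (1 / μ₀) :=
  abcExpOn_farFromCusps_of_licenceOn_mu_szpiroBad_degOne hμ₀ hμ₁ M archPk archSub Ψ act Mmod region n lat sig split qData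
    (fun P l T => letI := T.instFieldF; letI := T.instNumberFieldF; letI := T.instAlgebraF; letI := T.instFieldK;
        letI := T.instNumberFieldK; letI := T.instAlgebraK; letI := T.instFieldFbar; letI := T.instAlgebraFbar;
        letI := T.instAlgebraKFbar; letI := T.instIsElliptic;
      sigmaLevelWindow (pilotDataOfK T.D T.K) (exists_realising_qIdeles_pilotDataOfK T.D).choose
        (exists_realising_thetaIdeles_pilotDataOfK T.D).choose)
    (fun P _ _ l _ _ _ _ _ _ _ T => by
      letI := T.instFieldF; letI := T.instNumberFieldF; letI := T.instAlgebraF; letI := T.instFieldK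
      letI := T.instNumberFieldK; letI := T.instAlgebraK; letI := T.instFieldFbar; letI := T.instAlgebraFbar
      letI := T.instAlgebraKFbar; letI := T.instIsElliptic
      exact licenceOn_sigmaLevelWindow_chosen T.D (M P l T) (archPk P l T) (archSub P l T) (Ψ P l T) (act P l T) (Mmod P l T) (region P l T)
        (n P l T) (lat P l T) (sig P l T) (split P l T) (qData P l T))
    hMu18₁ h0 h2

/-! ## §2. ROW 15: `σ := Σ₁₅(T; n₀, λ, m_q)` — the slot-reach window of SOME certified dictionary (routed through the Σ_lic endpoint) -/

/-- **`abcExpOn_farFromCusps_of_mu_sigma15_content_hregC` — F5 (a) AT ROW 15's Σ₁₅, LICENCE DISCHARGED.** Explicit 2 = [MU-C at Σ₁₅] 1 · [CONE-C] 1: for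
`μ₀ ∈ (0, 1]`, IF at every admissible `(P, l)` on the content locus and every genuine Θ-volume datum `T` SOME CERTIFIED window dictionary `(n₀, λ, m_q)` (inner
non-log-unit certificate, outer log-unit certificate, integer Kummer orders `m_q(w) = P_q(w)` at the bad places — the side conditions of this seat's door
p469830, inhabited at every datum) has its slot-reach window `Σ₁₅(T; n₀, λ, m_q) := sigmaSlotReach (pilotDataOfK T.D T.K) ramIdx n₀ λ (j²·m_q) m_q` (abc-iut-rh-typ-12)
retaining the mass, `B_triv(Σ₁₅ᶜ) ≤ (1−μ₀)·T.gap + Tol(P,l)`, and [CONE-C] `hregC`, THEN for every `ρ ∈ (0, 1/2]`: **`ABCWithExponentOn {λ ρ-far from the cusps} (1/μ₀)`**.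
PROOF = the companion's hypothesis-minimal endpoint `abcExpOn_farFromCusps_of_mu_licenceCells_content_hregC` fed, per datum, with `Σ₁₅ ⊆ Σ_lic`
(`licenceOn_sigmaSlotReach_chosen` + `offTrivialMass_licenceCells_le_of_licenceOn_chosen` + `offSigmaTolerance_mono`). CONDITIONAL; engages no tabulated datum;
«follows AS TYPED», nothing more; no side taken on [IUTchIII] Cor. 3.12 or on any author. [cite: Mochizuki2012, IUTchIV Thm. 1.10 pp. 22–31; Cor. 2.2 (ii)–(iii)
pp. 41–48] [cite: DupuyHilado2025, §3.3, §3.4, §3.9, §4.9] [claim: Mochizuki2012, status: disputed] -/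
theorem abcExpOn_farFromCusps_of_mu_sigma15_content_hregC {μ₀ : ℝ} (hμ₀ : 0 < μ₀) (hμ₁ : μ₀ ≤ 1)
    -- [MU-C at Σ₁₅] some certified dictionary's slot-reach window retains `≥ μ₀·T.gap − Tol(P,l)` of the mass at every content-locus datum
    (hMu15 : ∀ P : NFPoint, P ∈ UP → ∀ l : ℕ, l.Prime → 5 ≤ l →
      Cor22.AdmitsCore P → Cor22.CondP2 P l → Cor22.CondP5 P l → Cor22.CondP6 P l →
      6 * ((1 + 20 * (Cor22.dmod P : ℝ) / l) * (P.logDiff + Cor22.logCondAvoid P {2, l}))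
          + 120 * (2 ^ 12 * 3 ^ 3 * 5 * (Cor22.dmod P : ℝ) * l) < Cor22.logQAvoid P {2, l} →
      ∀ T : Cor22.ThetaVolumeDatumAt P l, letI := T.instFieldF; letI := T.instNumberFieldF; letI := T.instAlgebraF; letI := T.instFieldK;
        letI := T.instNumberFieldK; letI := T.instAlgebraK; letI := T.instFieldFbar; letI := T.instAlgebraFbar;
        letI := T.instAlgebraKFbar; letI := T.instIsElliptic;
      ∃ (n₀ : ∀ pp : Nat.Primes, (thetaIndex (pilotDataOfK T.D T.K)).Fibre (.inr pp) → ℕ)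
        (lam : ∀ pp : Nat.Primes, (thetaIndex (pilotDataOfK T.D T.K)).Fibre (.inr pp) → ℝ)
        (mq : ∀ pp : Nat.Primes, (thetaIndex (pilotDataOfK T.D T.K)).Fibre (.inr pp) → ℤ),
        (∀ (pp : Nat.Primes) (x : (thetaIndex (pilotDataOfK T.D T.K)).Fibre (.inr pp)), haveI : Fact (pp : ℕ).Prime := ⟨pp.2⟩;
          ∃ u : kOf (pilotDataOfK T.D T.K) pp.1 x,
            ‖u‖ ≤ (pp : ℝ) ^ (-(((n₀ pp x : ℤ) - 1 : ℤ) : ℝ) / (ramIdx T.K (placeOf (pilotDataOfK T.D T.K) pp.1 x) : ℝ)) ∧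
              u ∉ (logUnits (kOf (pilotDataOfK T.D T.K) pp.1 x) : Set (kOf (pilotDataOfK T.D T.K) pp.1 x))) ∧
        (∀ (pp : Nat.Primes) (x : (thetaIndex (pilotDataOfK T.D T.K)).Fibre (.inr pp)), haveI : Fact (pp : ℕ).Prime := ⟨pp.2⟩;
          ∃ z ∈ (logUnits (kOf (pilotDataOfK T.D T.K) pp.1 x) : Set (kOf (pilotDataOfK T.D T.K) pp.1 x)), (pp : ℝ) ^ (lam pp x) ≤ ‖z‖) ∧
        (∀ (pp : Nat.Primes) (w : (thetaIndex (pilotDataOfK T.D T.K)).Fibre (.inr pp)), haveI : Fact (pp : ℕ).Prime := ⟨pp.2⟩;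
          placeOf (pilotDataOfK T.D T.K) pp.1 w ∈ (pilotDataOfK T.D T.K).S →
            (mq pp w : ℝ) = (pilotDataOfK T.D T.K).qPilot (placeOf (pilotDataOfK T.D T.K) pp.1 w)) ∧
        OffSigmaTolerance (1 - μ₀) (tol P l) T
          (offTrivialMass
            (settingPrVolSharp (pilotDataOfK T.D T.K) (logvAnalytic_analyticLogv (F := T.K)) (M P l T) (archPk P l T) (archSub P l T) (Ψ P l T)
            (act P l T) (Mmod P l T) (region P l T) (n P l T) (lat P l T) (sig P l T) (split P l T) (qData P l T)
            (exists_realising_qIdeles_pilotDataOfK T.D).choose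
            (exists_realising_thetaIdeles_pilotDataOfK T.D).choose
            (exists_realising_qIdeles_pilotDataOfK T.D).choose_spec.1
            (exists_realising_qIdeles_pilotDataOfK T.D).choose_spec.2.1)
            (sigmaSlotReach (pilotDataOfK T.D T.K)
              (fun pp x => haveI : Fact (pp : ℕ).Prime := ⟨pp.2⟩; ramIdx T.K (placeOf (pilotDataOfK T.D T.K) pp.1 x)) n₀ lam
              (fun pp i w => ((((i : ℕ) : ℤ) + 1) ^ 2) * mq pp w) mq)))
    -- [CONE-C] abc-iut-C-cert-1's `hregC` VERBATIM
    (hregC : ∀ P : NFPoint, P ∈ UP → ∀ l : ℕ, l.Prime → 5 ≤ l →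
      Cor22.AdmitsCore P → Cor22.CondP2 P l → Cor22.CondP5 P l → Cor22.CondP6 P l →
      6 * ((1 + 20 * (Cor22.dmod P : ℝ) / l) * (P.logDiff + Cor22.logCondAvoid P {2, l}))
          + 120 * (2 ^ 12 * 3 ^ 3 * 5 * (Cor22.dmod P : ℝ) * l) < Cor22.logQAvoid P {2, l} →
      ∀ T : Cor22.ThetaVolumeDatumAt P l,
        (letI := T.instFieldF; letI := T.instNumberFieldF; letI := T.instAlgebraF; letI := T.instFieldK
         letI := T.instNumberFieldK; letI := T.instAlgebraK; letI := T.instFieldFbar; letI := T.instAlgebraFbar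
         letI := T.instAlgebraKFbar; letI := T.instIsElliptic
         ¬ (∀ p ∈ T.I.supportPrimes, ∀ v w : placesOver (fieldOfModuli T.E) p,
            (Summit.ABC.IUTFork.DHData.ofInput T.I).logQloc p v = (Summit.ABC.IUTFork.DHData.ofInput T.I).logQloc p w)) →
        T.HullEstimateOf
          (((l : ℝ) + 1) / 4 *
            ((1 + 12 * (Cor22.dmod P : ℝ) / l) * (P.logDiff + Cor22.logCondAvoid P {2, l})
              + 2 * Real.log l + 52
              + 20 / 3 * Real.log (((2 ^ 12 * 3 ^ 3 * 5 * Cor22.dmod P : ℕ) : ℝ) * (l : ℝ))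
                * (Nat.primeCounting (2 ^ 12 * 3 ^ 3 * 5 * Cor22.dmod P * l) : ℝ))))
    {ρ : ℝ} (h0 : 0 < ρ) (h2 : ρ ≤ 1 / 2) :
    ABCWithExponentOn {P : NFPoint | P.FarFromCusps ({2} : Finset ℕ) ρ} (1 / μ₀) :=
  abcExpOn_farFromCusps_of_mu_licenceCells_content_hregC M archPk archSub Ψ act Mmod region n lat sig split qData hμ₀ hμ₁
    (fun P hP l hl h5 hcore hP2 hP5 hP6 hg T => by
      letI := T.instFieldF; letI := T.instNumberFieldF; letI := T.instAlgebraF; letI := T.instFieldK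
      letI := T.instNumberFieldK; letI := T.instAlgebraK; letI := T.instFieldFbar; letI := T.instAlgebraFbar
      letI := T.instAlgebraKFbar; letI := T.instIsElliptic
      obtain ⟨n₀, lam, mq, hn₀, hlam, hmq, hMu⟩ := hMu15 P hP l hl h5 hcore hP2 hP5 hP6 hg T
      exact offSigmaTolerance_mono T
        (offTrivialMass_licenceCells_le_of_licenceOn_chosen T.D (M P l T) (archPk P l T) (archSub P l T) (Ψ P l T) (act P l T) (Mmod P l T)
          (region P l T) (n P l T) (lat P l T) (sig P l T) (split P l T) (qData P l T) _
          (licenceOn_sigmaSlotReach_chosen T.D (M P l T) (archPk P l T) (archSub P l T) (Ψ P l T) (act P l T) (Mmod P l T) (region P l T)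
            (n P l T) (lat P l T) (sig P l T) (split P l T) (qData P l T) n₀ lam mq hn₀ hlam hmq))
        hMu)
    hregC h0 h2

/-- **`abcExpOn_farFromCusps_of_mu_sigma15_szpiroBad_degOne` — F5 (a) CONE-FREE AT ROW 15's Σ₁₅: ONE Σ-HYPOTHESIS.** Explicit 1 = [MU₁-bad at Σ₁₅]: for
`μ₀ ∈ (0, 1]`, IF at every SZPIRO-BAD admissible RATIONAL `(P, l)` and every genuine Θ-volume datum `T` some CERTIFIED dictionary `(n₀, λ, m_q)` has its slot-reach
window `Σ₁₅(T; n₀, λ, m_q)` retaining `≥ μ₀·T.gap − Tol(P,l)` of the `(j²−1)`-mass, THEN for every `ρ ∈ (0, 1/2]`: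
**`ABCWithExponentOn {λ ρ-far from the cusps at ∞, 2} (1/μ₀)`** — «S|Σ₁₅ ⟹ abc with exponent `1/μ₀`» with S|Σ₁₅ a THEOREM (door p469830). PROOF = the companion's
`abcExpOn_farFromCusps_of_mu_licenceCells_szpiroBad_degOne` with `Σ₁₅ ⊆ Σ_lic` per datum. HONEST STATUS: engaged at the tier-1 Frey–Legendre data (p480214),
where the slot-window mass fractions of record are numerics (FREY-133 median `≈ 0.52`), not theorems — undecided as typed. CONDITIONAL; no side taken on
[IUTchIII] Cor. 3.12 or on any author. [cite: Mochizuki2012, IUTchIV Cor. 2.2 (ii)–(iii) pp. 41–48] [cite: DupuyHilado2025, §3.3, §3.4, §3.9, §4.9]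
[claim: Mochizuki2012, status: disputed] -/
theorem abcExpOn_farFromCusps_of_mu_sigma15_szpiroBad_degOne {μ₀ : ℝ} (hμ₀ : 0 < μ₀) (hμ₁ : μ₀ ≤ 1)
    -- [MU₁-bad at Σ₁₅] some certified dictionary's slot-reach window retains `≥ μ₀·T.gap − Tol(P,l)` at every Szpiro-bad admissible RATIONAL datum
    (hMu15₁ : ∀ P : NFPoint, P ∈ UP → P.degree ≤ 1 → ∀ l : ℕ, l.Prime → 5 ≤ l →
      Cor22.AdmitsCore P → Cor22.CondP2 P l → Cor22.CondP5 P l → Cor22.CondP6 P l →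
      (((l : ℝ) + 5) / 4 < (Cor22.dmod P : ℝ) ∨
        6 * l * (((l : ℝ) + 5) - 4 * Cor22.dmod P) / (((l : ℝ) + 4) * ((l : ℝ) - 3))
            * (P.logDiff + (1 - 1 / (l : ℝ)) * Cor22.logCondAvoid P {2, l})
          + 6 * l * ((l : ℝ) + 5) / (((l : ℝ) + 4) * ((l : ℝ) - 3)) * Real.log Real.pi < Cor22.logQAvoid P {2, l}) →
      ∀ T : Cor22.ThetaVolumeDatumAt P l, letI := T.instFieldF; letI := T.instNumberFieldF; letI := T.instAlgebraF; letI := T.instFieldK;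
        letI := T.instNumberFieldK; letI := T.instAlgebraK; letI := T.instFieldFbar; letI := T.instAlgebraFbar;
        letI := T.instAlgebraKFbar; letI := T.instIsElliptic;
      ∃ (n₀ : ∀ pp : Nat.Primes, (thetaIndex (pilotDataOfK T.D T.K)).Fibre (.inr pp) → ℕ)
        (lam : ∀ pp : Nat.Primes, (thetaIndex (pilotDataOfK T.D T.K)).Fibre (.inr pp) → ℝ)
        (mq : ∀ pp : Nat.Primes, (thetaIndex (pilotDataOfK T.D T.K)).Fibre (.inr pp) → ℤ),
        (∀ (pp : Nat.Primes) (x : (thetaIndex (pilotDataOfK T.D T.K)).Fibre (.inr pp)), haveI : Fact (pp : ℕ).Prime := ⟨pp.2⟩;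
          ∃ u : kOf (pilotDataOfK T.D T.K) pp.1 x,
            ‖u‖ ≤ (pp : ℝ) ^ (-(((n₀ pp x : ℤ) - 1 : ℤ) : ℝ) / (ramIdx T.K (placeOf (pilotDataOfK T.D T.K) pp.1 x) : ℝ)) ∧
              u ∉ (logUnits (kOf (pilotDataOfK T.D T.K) pp.1 x) : Set (kOf (pilotDataOfK T.D T.K) pp.1 x))) ∧
        (∀ (pp : Nat.Primes) (x : (thetaIndex (pilotDataOfK T.D T.K)).Fibre (.inr pp)), haveI : Fact (pp : ℕ).Prime := ⟨pp.2⟩;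
          ∃ z ∈ (logUnits (kOf (pilotDataOfK T.D T.K) pp.1 x) : Set (kOf (pilotDataOfK T.D T.K) pp.1 x)), (pp : ℝ) ^ (lam pp x) ≤ ‖z‖) ∧
        (∀ (pp : Nat.Primes) (w : (thetaIndex (pilotDataOfK T.D T.K)).Fibre (.inr pp)), haveI : Fact (pp : ℕ).Prime := ⟨pp.2⟩;
          placeOf (pilotDataOfK T.D T.K) pp.1 w ∈ (pilotDataOfK T.D T.K).S →
            (mq pp w : ℝ) = (pilotDataOfK T.D T.K).qPilot (placeOf (pilotDataOfK T.D T.K) pp.1 w)) ∧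
        OffSigmaTolerance (1 - μ₀) (tol P l) T
          (offTrivialMass
            (settingPrVolSharp (pilotDataOfK T.D T.K) (logvAnalytic_analyticLogv (F := T.K)) (M P l T) (archPk P l T) (archSub P l T) (Ψ P l T)
            (act P l T) (Mmod P l T) (region P l T) (n P l T) (lat P l T) (sig P l T) (split P l T) (qData P l T)
            (exists_realising_qIdeles_pilotDataOfK T.D).choose
            (exists_realising_thetaIdeles_pilotDataOfK T.D).choose
            (exists_realising_qIdeles_pilotDataOfK T.D).choose_spec.1
            (exists_realising_qIdeles_pilotDataOfK T.D).choose_spec.2.1)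
            (sigmaSlotReach (pilotDataOfK T.D T.K)
              (fun pp x => haveI : Fact (pp : ℕ).Prime := ⟨pp.2⟩; ramIdx T.K (placeOf (pilotDataOfK T.D T.K) pp.1 x)) n₀ lam
              (fun pp i w => ((((i : ℕ) : ℤ) + 1) ^ 2) * mq pp w) mq)))
    {ρ : ℝ} (h0 : 0 < ρ) (h2 : ρ ≤ 1 / 2) :
    ABCWithExponentOn {P : NFPoint | P.FarFromCusps ({2} : Finset ℕ) ρ} (1 / μ₀) :=
  abcExpOn_farFromCusps_of_mu_licenceCells_szpiroBad_degOne M archPk archSub Ψ act Mmod region n lat sig split qData hμ₀ hμ₁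
    (fun P hP hdeg l hl h5 hcore hP2 hP5 hP6 hbad T => by
      letI := T.instFieldF; letI := T.instNumberFieldF; letI := T.instAlgebraF; letI := T.instFieldK
      letI := T.instNumberFieldK; letI := T.instAlgebraK; letI := T.instFieldFbar; letI := T.instAlgebraFbar
      letI := T.instAlgebraKFbar; letI := T.instIsElliptic
      obtain ⟨n₀, lam, mq, hn₀, hlam, hmq, hMu⟩ := hMu15₁ P hP hdeg l hl h5 hcore hP2 hP5 hP6 hbad T
      exact offSigmaTolerance_mono T
        (offTrivialMass_licenceCells_le_of_licenceOn_chosen T.D (M P l T) (archPk P l T) (archSub P l T) (Ψ P l T) (act P l T) (Mmod P l T)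
          (region P l T) (n P l T) (lat P l T) (sig P l T) (split P l T) (qData P l T) _
          (licenceOn_sigmaSlotReach_chosen T.D (M P l T) (archPk P l T) (archSub P l T) (Ψ P l T) (act P l T) (Mmod P l T) (region P l T)
            (n P l T) (lat P l T) (sig P l T) (split P l T) (qData P l T) n₀ lam mq hn₀ hlam hmq))
        hMu)
    h0 h2

end Rows

end Summit.ABC.IUTFork.Repair.RH2SigmaHull

end
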